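import Literature.MathematicalPhysics.PowerSystems.OscillatorNetworkTypeCounts
import Literature.MathematicalPhysics.PowerSystems.AcyclicSynchronizationCondition
import HarnessLib

/-!
# The multistability census of RADIAL oscillator networks: `2^{N−1}` synchronous states,
# `C(N−1, k)` of type `k`, exactly one stable — first-order (Kuramoto / droop) and swing models
# (Manik–Timme–Witthaut Cor. 2, Delabays–Coletta–Jacquod, Dörfler–Chertkov–Bullo (G1), Chiang)

Topic `Literature/MathematicalPhysics/PowerSystems`; namespaces `…PowerSystems` (§1),
`…NonuniformKuramoto` (§2), `…ClassicalModel.LosslessSystem` (§3). This file COMPOSES, with no new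
definition or fact, the tree type theorems of `OscillatorNetworkTypeCounts.lean`
(`tree_type_auxJac`, `tree_type_phaseJac`) with the radial-network fixed-point machinery of
`AcyclicSynchronizationCondition.lean` (namespace `ClassicalModel.RadialNetwork`: `flow_eq_treeFlow`,
`treeFlow_unique`, `exists_pinned_equilibrium_of_branch`, `pinned_equilibrium_eq_of_branch_eq`,
`ncard_pinned_equilibria_eq`). Everything is PROVED: 0 definitions, 0 named facts, 0 `sorry`.

SOURCES (read on the page; see the two imported files for the locators): D. Manik, M. Timme,
D. Witthaut, Chaos 27 (2017) [ManikTimmeWitthaut2017] §5.2 **Corollary 2** («for a tree network …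
one is stable and `2^{N−1} − 1` are unstable»; arXiv:1611.09825 p0010–p0011) with §2 Lemma 1;
R. Delabays, T. Coletta, P. Jacquod, J. Math. Phys. 57 (2016) [DelabaysColettaJacquod2016] §3,
Def. 3.7 (branches `arcsin` / `π − arcsin`); F. Dörfler, M. Chertkov, F. Bullo, PNAS 110 (2013)
[DorflerChertkovBullo2013] SI §3 Thm 1 (1), Thm 2 (G1); J. C. Bronski, L. DeVille, SIAM J. Appl.
Math. 74 (2014) [BronskiDeVille2014] Thm 2.8; H.-D. Chiang, C.-C. Chu, G. Cauley, Proc. IEEE 83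
(1995) [Chiang1995] §6.3 Thm 6.1, §6 Thm 6.7 (R1).

SETTING. A radial network on `Fin N`: `root`, `parent`, `depth` (`depth root = 0`, `depth i =
depth (parent i) + 1`), symmetric coupling supported on the tree edges with `a_i := C_{i, parent i}
> 0`; injections / natural frequencies `P` with TREE FLOWS `u` (the unique solution of the node
conservation identities `P_i = [i ≠ root] u_i − Σ_{children j} u_j`, data + `treeFlow_unique`),
STRICTLY feasible: `|u_i| < a_i` on every edge.

WHAT IS PROVED.
* §1 `edgeSin_eq_treeFlow` (every synchronous state `F(θ) = P` has `a_i sin(θ_i − θ_{parent i}) =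
  u_i`), `edgeCos_ne_zero_of_treeFlow_lt` (hence no degenerate edge: `cos(θ_i − θ_{parent i}) ≠ 0`).
* §2 FIRST-ORDER (`Kur : NonuniformKuramoto N`, ANY `D_i > 0`; synchronous state = `Σⱼ Pᵢⱼ sin(θᵢ −
  θⱼ) = ωᵢ`): ★★★ **`radial_type_auxJac`** — EVERY synchronous state is hyperbolic modulo rotation
  with exactly `#{edges with cos(θᵢ − θ_{parent i}) < 0}` roots of `−D⁻¹L(θ)` in the open right
  half-plane, `#{cos > 0}` in the open left half-plane, one on the axis; ★★★ **`radial_census_auxJac`**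
  — every branch pattern `σ` is realised by a pinned synchronous state in `[−π, π)ᴺ` of type
  `#{i ≠ root : σ i = false}`; ★★★ **`ncard_pinned_fixedPoints_of_type`** — exactly `C(N − 1, k)`
  pinned synchronous states have type `k` (so exactly ONE is stable, `2^{N−1} − 1` are unstable).
* §3 SWING (`S : ClassicalModel.LosslessSystem N 0`, `Mᵢ, Dᵢ > 0`, Jacobian `phaseJac θ` at
  `(θ, 0)`): ★★★ `radial_type_phaseJac`, ★★★ `radial_census_phaseJac`,
  ★★★ `ncard_pinned_syncStates_of_type` — the same census (LHP counts shifted by `N`).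

THREE COLUMNS. CERTIFIED: kernel theorems — the complete type census of the synchronous states of
a radial lossless network with strictly feasible flows, in both model tiers. MODELLED: radial
(distribution-feeder / radial-microgrid) topology, lossless lines, constant voltages; first-order
oscillators / droop inverters (any time constants) and classical swing machines (any inertias and
dampings). NOT CLAIMED: meshed networks, marginal flows `|u_i| = a_i`, lossy lines, regions of
attraction.
-/

noncomputable section

open Real Set Filter Topology Metric Finset Matrix
open scoped Matrix

namespace Literature.MathematicalPhysics.PowerSystems

/-! ### §1. Edge sines of a synchronous state on a radial network are the tree flows -/

section TreeFlows

variable {n : ℕ}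

/-- **On a radial network the edge sines of every synchronous state are the tree flows**
(DCB SI Theorem 1 (1) with `Ker B = 0`): if `F(θ) = P` and `u` are the (unique) tree flows of
`P`, then `a_i sin(θ_i − θ_{parent i}) = u_i` on every edge.
[cite: DorflerChertkovBullo2013, SI §3 Theorem 1 (1) and Theorem 2 (G1) proof («For an acyclic graph we have that Ker(B) = ∅ … Bᵀθ* = arcsin(BᵀL†ω)»)] -/
theorem edgeSin_eq_treeFlow {root : Fin n} {parent : Fin n → Fin n} {depth : Fin n → ℕ}
    (hdepth : ∀ i, i ≠ root → depth i = depth (parent i) + 1)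
    (C : Fin n → Fin n → ℝ) (hC : ∀ i j, C i j = C j i)
    (htree : ∀ i j, i ≠ j → C i j ≠ 0 → (i ≠ root ∧ j = parent i) ∨ (j ≠ root ∧ i = parent j))
    (P u : Fin n → ℝ)
    (hcons : ∀ i, P i = (if i ≠ root then u i else 0)
      - ∑ j ∈ Finset.univ.filter (fun j => j ≠ root ∧ parent j = i), u j)
    {θ : Fin n → ℝ} (heq : ∀ i, ∑ j, C i j * Real.sin (θ i - θ j) = P i) :
    ∀ i, i ≠ root → C i (parent i) * Real.sin (θ i - θ (parent i)) = u i := by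
  classical
  set d : Fin n → ℝ := fun i => C i (parent i) * Real.sin (θ i - θ (parent i)) - u i with hd
  have hcons' : ∀ i, (if i ≠ root then d i else 0)
      = ∑ j ∈ Finset.univ.filter (fun j => j ≠ root ∧ parent j = i), d j := by
    intro i
    have h1 := ClassicalModel.RadialNetwork.flow_eq_treeFlow hdepth C hC htree θ i
    rw [heq i, hcons i] at h1
    simp only [hd, Finset.sum_sub_distrib]
    by_cases hi : i ≠ root
    · rw [if_pos hi, if_pos hi] at h1
      rw [if_pos hi]
      linarith
    · rw [if_neg hi, if_neg hi] at h1
      rw [if_neg hi]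
      linarith
  intro i hi
  have := ClassicalModel.RadialNetwork.treeFlow_unique hdepth d hcons' i hi
  simp only [hd] at this
  linarith

/-- Hence, for STRICTLY feasible flows (`|u_i| < a_i`), no edge of a synchronous state is degenerate:
`cos(θ_i − θ_{parent i}) ≠ 0`. [cite: DorflerChertkovBullo2013, SI §3 Theorem 2 (G1); DelabaysColettaJacquod2016, Def. 3.7 (the two branches `arcsin`, `π − arcsin`)] -/
theorem edgeCos_ne_zero_of_treeFlow_lt {root : Fin n} {parent : Fin n → Fin n} {depth : Fin n → ℕ}
    (hdepth : ∀ i, i ≠ root → depth i = depth (parent i) + 1)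
    (C : Fin n → Fin n → ℝ) (hC : ∀ i j, C i j = C j i)
    (htree : ∀ i j, i ≠ j → C i j ≠ 0 → (i ≠ root ∧ j = parent i) ∨ (j ≠ root ∧ i = parent j))
    (ha : ∀ i, i ≠ root → 0 < C i (parent i)) (P u : Fin n → ℝ)
    (hcons : ∀ i, P i = (if i ≠ root then u i else 0)
      - ∑ j ∈ Finset.univ.filter (fun j => j ≠ root ∧ parent j = i), u j)
    (hu : ∀ i, i ≠ root → |u i| < C i (parent i))
    {θ : Fin n → ℝ} (heq : ∀ i, ∑ j, C i j * Real.sin (θ i - θ j) = P i) :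
    ∀ i, i ≠ root → Real.cos (θ i - θ (parent i)) ≠ 0 := by
  intro i hi hcos
  have hs := edgeSin_eq_treeFlow hdepth C hC htree P u hcons heq i hi
  have hsin : Real.sin (θ i - θ (parent i)) ^ 2 = 1 := by
    have := Real.sin_sq_add_cos_sq (θ i - θ (parent i))
    rw [hcos] at this
    linarith
  have habs : |Real.sin (θ i - θ (parent i))| = 1 := by
    have h0 : 0 ≤ |Real.sin (θ i - θ (parent i))| := abs_nonneg _
    have h1 : |Real.sin (θ i - θ (parent i))| ^ 2 = 1 := by rw [sq_abs]; exact hsin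
    nlinarith
  have h1 : |u i| = C i (parent i) := by
    rw [← hs, abs_mul, abs_of_pos (ha i hi), habs, mul_one]
  exact absurd h1 (hu i hi).ne

end TreeFlows

/-! ### Patterns with a prescribed number of `−` edges -/

section Patterns

variable {n : ℕ}

/-- Branch patterns normalised at the root (`σ root = true`) with exactly `k` edges on the `−`
branch are counted by `C(N − 1, k)` (choose the `−` edges among the `N − 1` edges). [folklore] -/
private theorem card_patterns_false_eq (root : Fin n) (k : ℕ) :
    (Finset.univ.filter fun σ : Fin n → Bool =>
        σ root = true ∧ (Finset.univ.filter fun i => i ≠ root ∧ σ i = false).card = k).card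
      = (n - 1).choose k := by
  classical
  have hpc : ((Finset.univ.erase root).powersetCard k).card = (n - 1).choose k := by
    rw [Finset.card_powersetCard, Finset.card_erase_of_mem (Finset.mem_univ root), Finset.card_univ,
      Fintype.card_fin]
  rw [← hpc]
  refine Finset.card_bij (fun σ _ => Finset.univ.filter fun i => σ i = false) ?_ ?_ ?_
  · intro σ hσ
    simp only [Finset.mem_filter, Finset.mem_univ, true_and] at hσ
    rw [Finset.mem_powersetCard]
    refine ⟨fun i hi => ?_, ?_⟩
    · simp only [Finset.mem_filter, Finset.mem_univ, true_and] at hi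
      rw [Finset.mem_erase]
      exact ⟨fun h => by rw [h, hσ.1] at hi; exact Bool.noConfusion hi, Finset.mem_univ i⟩
    · rw [← hσ.2]
      congr 1
      refine Finset.filter_congr fun i _ => ?_
      constructor
      · intro hi
        exact ⟨fun h => by rw [h, hσ.1] at hi; exact Bool.noConfusion hi, hi⟩
      · exact fun h => h.2
  · intro σ₁ h₁ σ₂ h₂ h
    funext i
    have hi := congrArg (fun s : Finset (Fin n) => i ∈ s) h
    simp only [Finset.mem_filter, Finset.mem_univ, true_and, eq_iff_iff] at hi
    cases h1 : σ₁ i <;> cases h2 : σ₂ i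
    · rfl
    · exact absurd (hi.1 h1) (by rw [h2]; exact Bool.noConfusion)
    · exact absurd (hi.2 h2) (by rw [h1]; exact Bool.noConfusion)
    · rfl
  · intro s hs
    rw [Finset.mem_powersetCard] at hs
    refine ⟨fun i => decide (i ∉ s), ?_, ?_⟩
    · simp only [Finset.mem_filter, Finset.mem_univ, true_and, decide_eq_true_eq]
      refine ⟨fun h => by have := hs.1 h; simp at this, ?_⟩
      rw [← hs.2]
      congr 1
      ext i
      simp only [Finset.mem_filter, Finset.mem_univ, true_and, decide_eq_false_iff_not, not_not]
      constructor
      · exact fun h => h.2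
      · intro hi
        exact ⟨fun h => by rw [h] at hi; have := hs.1 hi; simp at this, hi⟩
    · ext i
      simp only [Finset.mem_filter, Finset.mem_univ, true_and, decide_eq_false_iff_not, not_not]

end Patterns

/-! ### §2. First-order (Kuramoto / droop) radial networks: the type census -/

namespace NonuniformKuramoto

variable {n : ℕ} (Kur : NonuniformKuramoto n)

/-- ★★★ **TYPE OF EVERY SYNCHRONOUS STATE OF A RADIAL KURAMOTO / DROOP NETWORK**: symmetric coupling
`P` supported on a rooted tree with positive edge weights `a_i = P_{i, parent i}`, ANY time constants
`D_i > 0`, natural frequencies `ω` whose tree flows `u` are STRICTLY feasible (`|u_i| < a_i`). Then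
EVERY synchronous state `θ` (`Σⱼ Pᵢⱼ sin(θᵢ − θⱼ) = ωᵢ`) is hyperbolic modulo rotation, and the
Jacobian `−D⁻¹L(θ)` has exactly `#{edges with cos(θᵢ − θ_{parent i}) < 0}` characteristic roots in
the open right half-plane, exactly `#{edges with cos > 0}` in the open left half-plane and exactly
one on the imaginary axis. [cite: ManikTimmeWitthaut2017, §5.2 Corollary 2 («Λ(θ*) is positive semi-definite if and only if cos(θ*_j − θ*_i) ≥ 0 for all edges») with §2 Lemma 1; BronskiDeVille2014, §2.2 Theorem 2.8; DorflerChertkovBullo2013, SI §3 Theorem 2 (G1); Chiang1995, §6 Theorem 6.7 (R1)] -/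
theorem radial_type_auxJac {root : Fin n} {parent : Fin n → Fin n} {depth : Fin n → ℕ}
    (hdepth : ∀ i, i ≠ root → depth i = depth (parent i) + 1) (hD : ∀ i, 0 < Kur.D i)
    (hP : ∀ i j, Kur.P i j = Kur.P j i)
    (htree : ∀ i j, i ≠ j → Kur.P i j ≠ 0 → (i ≠ root ∧ j = parent i) ∨ (j ≠ root ∧ i = parent j))
    (ha : ∀ i, i ≠ root → 0 < Kur.P i (parent i)) (u : Fin n → ℝ)
    (hcons : ∀ i, Kur.ω i = (if i ≠ root then u i else 0)
      - ∑ j ∈ Finset.univ.filter (fun j => j ≠ root ∧ parent j = i), u j)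
    (hu : ∀ i, i ≠ root → |u i| < Kur.P i (parent i))
    {θ : Fin n → ℝ} (heq : ∀ i, ∑ j, Kur.P i j * Real.sin (θ i - θ j) = Kur.ω i) :
    ((Kur.toDroopNetwork.auxJac θ).map (algebraMap ℝ ℂ)).charpoly.roots.countP (fun μ => 0 < μ.re)
        = (univ.filter fun i => i ≠ root ∧ Real.cos (θ i - θ (parent i)) < 0).card
      ∧ ((Kur.toDroopNetwork.auxJac θ).map (algebraMap ℝ ℂ)).charpoly.roots.countP (fun μ => μ.re < 0)
        = (univ.filter fun i => i ≠ root ∧ 0 < Real.cos (θ i - θ (parent i))).card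
      ∧ ((Kur.toDroopNetwork.auxJac θ).map (algebraMap ℝ ℂ)).charpoly.roots.countP (fun μ => μ.re = 0)
        = 1 := by
  classical
  have hnd0 := edgeCos_ne_zero_of_treeFlow_lt hdepth Kur.P hP htree ha Kur.ω u hcons hu heq
  have hnd : ∀ i, i ≠ root → Kur.P i (parent i) * Real.cos (θ i - θ (parent i)) ≠ 0 :=
    fun i hi => mul_ne_zero (ha i hi).ne' (hnd0 i hi)
  obtain ⟨t1, t2, t3⟩ := Kur.tree_type_auxJac hdepth hD hP htree θ hnd
  have e1 : (univ.filter fun i => i ≠ root ∧ Kur.P i (parent i) * Real.cos (θ i - θ (parent i)) < 0)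
      = (univ.filter fun i => i ≠ root ∧ Real.cos (θ i - θ (parent i)) < 0) := by
    refine Finset.filter_congr fun i _ => ?_
    constructor
    · rintro ⟨hi, h⟩
      exact ⟨hi, by
        by_contra hc
        exact absurd h (not_lt.2 (mul_nonneg (ha i hi).le (not_lt.1 hc)))⟩
    · rintro ⟨hi, h⟩
      exact ⟨hi, mul_neg_of_pos_of_neg (ha i hi) h⟩
  have e2 : (univ.filter fun i => i ≠ root ∧ 0 < Kur.P i (parent i) * Real.cos (θ i - θ (parent i)))
      = (univ.filter fun i => i ≠ root ∧ 0 < Real.cos (θ i - θ (parent i))) := by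
    refine Finset.filter_congr fun i _ => ?_
    constructor
    · rintro ⟨hi, h⟩
      exact ⟨hi, pos_of_mul_pos_right h (ha i hi).le⟩
    · rintro ⟨hi, h⟩
      exact ⟨hi, mul_pos (ha i hi) h⟩
  rw [e1] at t1; rw [e2] at t2
  exact ⟨t1, t2, t3⟩

/-- ★★★ **THE RADIAL MULTISTABILITY CENSUS, first-order models** (all `2^{N−1}` branch patterns are
realised, with their types): under the hypotheses of `radial_type_auxJac` (tree flows strictly
feasible), for EVERY assignment `σ` of a branch (`+` = `arcsin`, `−` = `π − arcsin`) to the edges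
there is a synchronous state `θ`, pinned `θ_root = 0` and taken in `[−π, π)ᴺ`, whose edge above `i`
is on branch `σ i` (`cos(θᵢ − θ_{parent i}) ≥ 0 ↔ σ i`), and whose TYPE is the number of `−` edges:
the Jacobian `−D⁻¹L(θ)` has exactly `#{i ≠ root : σ i = false}` roots in the open right half-plane,
`#{i ≠ root : σ i = true}` in the open left half-plane, one on the axis. (With
`RadialNetwork.ncard_pinned_equilibria_eq`: these are ALL the `2^{N−1}` pinned synchronous states;
exactly one — the all-`+` pattern — is stable.)
[cite: ManikTimmeWitthaut2017, §5.2 Corollary 2 and the discussion of multistability on trees; DelabaysColettaJacquod2016, §3 / Def. 3.7; DorflerChertkovBullo2013, SI §3 Theorem 2 (G1); Chiang1995, §6 Theorem 6.7 (R1)] -/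
theorem radial_census_auxJac {root : Fin n} {parent : Fin n → Fin n} {depth : Fin n → ℕ}
    (hroot : depth root = 0) (hdepth : ∀ i, i ≠ root → depth i = depth (parent i) + 1)
    (hD : ∀ i, 0 < Kur.D i) (hP : ∀ i j, Kur.P i j = Kur.P j i)
    (htree : ∀ i j, i ≠ j → Kur.P i j ≠ 0 → (i ≠ root ∧ j = parent i) ∨ (j ≠ root ∧ i = parent j))
    (ha : ∀ i, i ≠ root → 0 < Kur.P i (parent i)) (u : Fin n → ℝ)
    (hcons : ∀ i, Kur.ω i = (if i ≠ root then u i else 0)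
      - ∑ j ∈ Finset.univ.filter (fun j => j ≠ root ∧ parent j = i), u j)
    (hu : ∀ i, i ≠ root → |u i| < Kur.P i (parent i)) (σ : Fin n → Bool) :
    ∃ θ : Fin n → ℝ, θ root = 0 ∧ (∀ i, θ i ∈ Set.Ico (-π) π) ∧
      (∀ i, ∑ j, Kur.P i j * Real.sin (θ i - θ j) = Kur.ω i) ∧
      (∀ i, i ≠ root → (0 ≤ Real.cos (θ i - θ (parent i)) ↔ σ i = true)) ∧
      ((Kur.toDroopNetwork.auxJac θ).map (algebraMap ℝ ℂ)).charpoly.roots.countP (fun μ => 0 < μ.re)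
          = (univ.filter fun i => i ≠ root ∧ σ i = false).card ∧
      ((Kur.toDroopNetwork.auxJac θ).map (algebraMap ℝ ℂ)).charpoly.roots.countP (fun μ => μ.re < 0)
          = (univ.filter fun i => i ≠ root ∧ σ i = true).card ∧
      ((Kur.toDroopNetwork.auxJac θ).map (algebraMap ℝ ℂ)).charpoly.roots.countP (fun μ => μ.re = 0)
          = 1 := by
  classical
  obtain ⟨θ, hθr, hbox, heq, hbr⟩ :=
    ClassicalModel.RadialNetwork.exists_pinned_equilibrium_of_branch hroot hdepth Kur.P hP htree ha
      Kur.ω u hcons hu σ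
  have hnd0 := edgeCos_ne_zero_of_treeFlow_lt hdepth Kur.P hP htree ha Kur.ω u hcons hu heq
  obtain ⟨t1, t2, t3⟩ := Kur.radial_type_auxJac hdepth hD hP htree ha u hcons hu heq
  refine ⟨θ, hθr, hbox, heq, hbr, ?_, ?_, t3⟩
  · rw [t1]
    refine congrArg Finset.card (Finset.filter_congr fun i _ => ?_)
    constructor
    · rintro ⟨hi, h⟩
      refine ⟨hi, ?_⟩
      have := (hbr i hi).not
      simpa using this.1 (not_le.2 h)
    · rintro ⟨hi, h⟩
      refine ⟨hi, ?_⟩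
      have h2 : ¬ (0 ≤ Real.cos (θ i - θ (parent i))) := fun h0 => by
        have := (hbr i hi).1 h0; rw [h] at this; exact Bool.false_ne_true this
      exact not_le.1 h2
  · rw [t2]
    refine congrArg Finset.card (Finset.filter_congr fun i _ => ?_)
    constructor
    · rintro ⟨hi, h⟩
      exact ⟨hi, (hbr i hi).1 h.le⟩
    · rintro ⟨hi, h⟩
      exact ⟨hi, lt_of_le_of_ne ((hbr i hi).2 h) (Ne.symm (hnd0 i hi))⟩

/-- ★★★ **`C(N − 1, k)` SYNCHRONOUS STATES OF TYPE `k`** on a radial first-order network with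
strictly feasible tree flows: among the `2^{N−1}` synchronous states pinned at the root in the
period box `[−π, π)ᴺ` (`RadialNetwork.ncard_pinned_equilibria_eq`), exactly `C(N − 1, k)` have
`k` characteristic roots of `−D⁻¹L(θ)` in the open right half-plane — in particular EXACTLY ONE
(`k = 0`) is stable and `2^{N−1} − 1` are unstable, with the binomial type distribution.
[cite: ManikTimmeWitthaut2017, §5.2 Corollary 2 («one is stable and 2^{N−1} − 1 are unstable»); DelabaysColettaJacquod2016, §3 / Def. 3.7; Chiang1995, §6 Theorem 6.7 (R1)] -/
theorem ncard_pinned_fixedPoints_of_type {root : Fin n} {parent : Fin n → Fin n} {depth : Fin n → ℕ}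
    (hroot : depth root = 0) (hdepth : ∀ i, i ≠ root → depth i = depth (parent i) + 1)
    (hD : ∀ i, 0 < Kur.D i) (hP : ∀ i j, Kur.P i j = Kur.P j i)
    (htree : ∀ i j, i ≠ j → Kur.P i j ≠ 0 → (i ≠ root ∧ j = parent i) ∨ (j ≠ root ∧ i = parent j))
    (ha : ∀ i, i ≠ root → 0 < Kur.P i (parent i)) (u : Fin n → ℝ)
    (hcons : ∀ i, Kur.ω i = (if i ≠ root then u i else 0)
      - ∑ j ∈ Finset.univ.filter (fun j => j ≠ root ∧ parent j = i), u j)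
    (hu : ∀ i, i ≠ root → |u i| < Kur.P i (parent i)) (k : ℕ) :
    {θ : Fin n → ℝ | θ root = 0 ∧ (∀ i, θ i ∈ Set.Ico (-π) π) ∧
      (∀ i, ∑ j, Kur.P i j * Real.sin (θ i - θ j) = Kur.ω i) ∧
      ((Kur.toDroopNetwork.auxJac θ).map (algebraMap ℝ ℂ)).charpoly.roots.countP
        (fun μ => 0 < μ.re) = k}.ncard = (n - 1).choose k := by
  classical
  set E : Set (Fin n → ℝ) := {θ : Fin n → ℝ | θ root = 0 ∧ (∀ i, θ i ∈ Set.Ico (-π) π) ∧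
      (∀ i, ∑ j, Kur.P i j * Real.sin (θ i - θ j) = Kur.ω i) ∧
      ((Kur.toDroopNetwork.auxJac θ).map (algebraMap ℝ ℂ)).charpoly.roots.countP
        (fun μ => 0 < μ.re) = k} with hE
  set S : Finset (Fin n → Bool) := Finset.univ.filter fun σ : Fin n → Bool =>
      σ root = true ∧ (Finset.univ.filter fun i => i ≠ root ∧ σ i = false).card = k with hS
  set key : (Fin n → ℝ) → (Fin n → Bool) := fun θ i =>
    if i = root then true else decide (0 ≤ Real.cos (θ i - θ (parent i))) with hkey
  have hkeycount : ∀ θ : Fin n → ℝ,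
      (Finset.univ.filter fun i => i ≠ root ∧ key θ i = false)
        = (Finset.univ.filter fun i => i ≠ root ∧ Real.cos (θ i - θ (parent i)) < 0) := by
    intro θ
    refine Finset.filter_congr fun i _ => ?_
    by_cases hi : i = root
    · simp [hi]
    · simp only [hkey, if_neg hi, decide_eq_false_iff_not, not_le]
  have hmaps : Set.MapsTo key E ↑S := by
    rintro θ ⟨-, -, heq, hk⟩
    simp only [hS, Finset.coe_filter, Finset.mem_univ, true_and, Set.mem_setOf_eq]
    refine ⟨by simp [hkey], ?_⟩
    rw [hkeycount, ← (Kur.radial_type_auxJac hdepth hD hP htree ha u hcons hu heq).1, hk]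
  have hinj : Set.InjOn key E := by
    rintro θ ⟨hr, hbox, heq, -⟩ θ' ⟨hr', hbox', heq', -⟩ hk
    refine ClassicalModel.RadialNetwork.pinned_equilibrium_eq_of_branch_eq hdepth Kur.P hP htree
      (fun i hi => (ha i hi).ne') Kur.ω hr hbox heq hr' hbox' heq' fun i hi => ?_
    have h := congr_fun hk i
    simp only [hkey, if_neg hi] at h
    simpa only [decide_eq_decide] using h
  have hsurj : Set.SurjOn key E ↑S := by
    intro σ hσ
    simp only [hS, Finset.coe_filter, Finset.mem_univ, true_and, Set.mem_setOf_eq] at hσ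
    obtain ⟨θ, hr, hbox, heq, hbr, ht, -, -⟩ :=
      Kur.radial_census_auxJac hroot hdepth hD hP htree ha u hcons hu σ
    refine ⟨θ, ⟨hr, hbox, heq, by rw [ht, hσ.2]⟩, ?_⟩
    funext i
    by_cases hi : i = root
    · subst hi; simp [hkey, hσ.1]
    · simp only [hkey, if_neg hi]
      cases h : σ i
      · simpa [h] using hbr i hi
      · simpa [h] using hbr i hi
  have himage : key '' E = ↑S := (Set.BijOn.mk hmaps hinj hsurj).image_eq
  rw [← hinj.ncard_image, himage, Set.ncard_coe_finset, card_patterns_false_eq]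

end NonuniformKuramoto

/-! ### §3. The classical swing model on a radial network: the same census for `(θ, 0)` -/

namespace ClassicalModel

namespace LosslessSystem

variable {n : ℕ} (S : LosslessSystem n 0)

/-- ★★★ **TYPE OF EVERY SYNCHRONOUS STATE `(θ, 0)` OF THE CLASSICAL SWING MODEL ON A RADIAL
NETWORK** (`C` symmetric on a rooted tree, `a_i = C_{i, parent i} > 0`, `Mᵢ, Dᵢ > 0`, injections
`P` with strictly feasible tree flows): the swing Jacobian at `(θ, 0)` has exactly
`#{edges with cos(θᵢ − θ_{parent i}) < 0}` roots in the open right half-plane, `#{cos > 0} + N` in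
the open left half-plane, one on the imaginary axis.
[cite: Chiang1995, §6.3 Theorem 6.1 and §6 Theorem 6.7 (R1); ManikTimmeWitthaut2017, §5.2 Corollary 2, §3 Lemma 1; BronskiDeVille2014, §2.2 Theorem 2.8; DorflerChertkovBullo2013, SI §3 Theorem 2 (G1)] -/
theorem radial_type_phaseJac {root : Fin n} {parent : Fin n → Fin n} {depth : Fin n → ℕ}
    (hdepth : ∀ i, i ≠ root → depth i = depth (parent i) + 1) (hC : ∀ i j, S.C i j = S.C j i)
    (htree : ∀ i j, i ≠ j → S.C i j ≠ 0 → (i ≠ root ∧ j = parent i) ∨ (j ≠ root ∧ i = parent j))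
    (ha : ∀ i, i ≠ root → 0 < S.C i (parent i)) (hM : ∀ i, 0 < S.M i) (hD : ∀ i, 0 < S.D i)
    (u : Fin n → ℝ)
    (hcons : ∀ i, S.P i = (if i ≠ root then u i else 0)
      - ∑ j ∈ Finset.univ.filter (fun j => j ≠ root ∧ parent j = i), u j)
    (hu : ∀ i, i ≠ root → |u i| < S.C i (parent i))
    {θ : Fin n → ℝ} (heq : ∀ i, ∑ j, S.C i j * Real.sin (θ i - θ j) = S.P i) :
    ((S.phaseJac θ).map (algebraMap ℝ ℂ)).charpoly.roots.countP (fun μ => 0 < μ.re)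
        = (univ.filter fun i => i ≠ root ∧ Real.cos (θ i - θ (parent i)) < 0).card
      ∧ ((S.phaseJac θ).map (algebraMap ℝ ℂ)).charpoly.roots.countP (fun μ => μ.re < 0)
        = (univ.filter fun i => i ≠ root ∧ 0 < Real.cos (θ i - θ (parent i))).card + n
      ∧ ((S.phaseJac θ).map (algebraMap ℝ ℂ)).charpoly.roots.countP (fun μ => μ.re = 0) = 1 := by
  classical
  have hnd0 := edgeCos_ne_zero_of_treeFlow_lt hdepth S.C hC htree ha S.P u hcons hu heq
  have hnd : ∀ i, i ≠ root → S.C i (parent i) * Real.cos (θ i - θ (parent i)) ≠ 0 :=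
    fun i hi => mul_ne_zero (ha i hi).ne' (hnd0 i hi)
  obtain ⟨t1, t2, t3⟩ := S.tree_type_phaseJac hdepth hC htree hM hD θ hnd
  have e1 : (univ.filter fun i => i ≠ root ∧ S.C i (parent i) * Real.cos (θ i - θ (parent i)) < 0)
      = (univ.filter fun i => i ≠ root ∧ Real.cos (θ i - θ (parent i)) < 0) := by
    refine Finset.filter_congr fun i _ => ?_
    constructor
    · rintro ⟨hi, h⟩
      exact ⟨hi, by
        by_contra hc
        exact absurd h (not_lt.2 (mul_nonneg (ha i hi).le (not_lt.1 hc)))⟩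
    · rintro ⟨hi, h⟩
      exact ⟨hi, mul_neg_of_pos_of_neg (ha i hi) h⟩
  have e2 : (univ.filter fun i => i ≠ root ∧ 0 < S.C i (parent i) * Real.cos (θ i - θ (parent i)))
      = (univ.filter fun i => i ≠ root ∧ 0 < Real.cos (θ i - θ (parent i))) := by
    refine Finset.filter_congr fun i _ => ?_
    constructor
    · rintro ⟨hi, h⟩
      exact ⟨hi, pos_of_mul_pos_right h (ha i hi).le⟩
    · rintro ⟨hi, h⟩
      exact ⟨hi, mul_pos (ha i hi) h⟩
  rw [e1] at t1; rw [e2] at t2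
  exact ⟨t1, t2, t3⟩

/-- ★★★ **THE RADIAL MULTISTABILITY CENSUS, swing model**: every branch pattern `σ` is realised by
a synchronous state `(θ, 0)` (pinned, in the period box) whose swing Jacobian has exactly
`#{i ≠ root : σ i = false}` roots in the open right half-plane, `#{i ≠ root : σ i = true} + N` in
the open left half-plane and one on the axis.
[cite: Chiang1995, §6.3 Theorem 6.1; ManikTimmeWitthaut2017, §5.2 Corollary 2; DelabaysColettaJacquod2016, Def. 3.7; DorflerChertkovBullo2013, SI §3 Theorem 2 (G1)] -/
theorem radial_census_phaseJac {root : Fin n} {parent : Fin n → Fin n} {depth : Fin n → ℕ}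
    (hroot : depth root = 0) (hdepth : ∀ i, i ≠ root → depth i = depth (parent i) + 1)
    (hC : ∀ i j, S.C i j = S.C j i)
    (htree : ∀ i j, i ≠ j → S.C i j ≠ 0 → (i ≠ root ∧ j = parent i) ∨ (j ≠ root ∧ i = parent j))
    (ha : ∀ i, i ≠ root → 0 < S.C i (parent i)) (hM : ∀ i, 0 < S.M i) (hD : ∀ i, 0 < S.D i)
    (u : Fin n → ℝ)
    (hcons : ∀ i, S.P i = (if i ≠ root then u i else 0)
      - ∑ j ∈ Finset.univ.filter (fun j => j ≠ root ∧ parent j = i), u j)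
    (hu : ∀ i, i ≠ root → |u i| < S.C i (parent i)) (σ : Fin n → Bool) :
    ∃ θ : Fin n → ℝ, θ root = 0 ∧ (∀ i, θ i ∈ Set.Ico (-π) π) ∧
      (∀ i, ∑ j, S.C i j * Real.sin (θ i - θ j) = S.P i) ∧
      (∀ i, i ≠ root → (0 ≤ Real.cos (θ i - θ (parent i)) ↔ σ i = true)) ∧
      ((S.phaseJac θ).map (algebraMap ℝ ℂ)).charpoly.roots.countP (fun μ => 0 < μ.re)
          = (univ.filter fun i => i ≠ root ∧ σ i = false).card ∧
      ((S.phaseJac θ).map (algebraMap ℝ ℂ)).charpoly.roots.countP (fun μ => μ.re < 0)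
          = (univ.filter fun i => i ≠ root ∧ σ i = true).card + n ∧
      ((S.phaseJac θ).map (algebraMap ℝ ℂ)).charpoly.roots.countP (fun μ => μ.re = 0) = 1 := by
  classical
  obtain ⟨θ, hθr, hbox, heq, hbr⟩ :=
    ClassicalModel.RadialNetwork.exists_pinned_equilibrium_of_branch hroot hdepth S.C hC htree ha
      S.P u hcons hu σ
  have hnd0 := edgeCos_ne_zero_of_treeFlow_lt hdepth S.C hC htree ha S.P u hcons hu heq
  obtain ⟨t1, t2, t3⟩ := S.radial_type_phaseJac hdepth hC htree ha hM hD u hcons hu heq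
  refine ⟨θ, hθr, hbox, heq, hbr, ?_, ?_, t3⟩
  · rw [t1]
    refine congrArg Finset.card (Finset.filter_congr fun i _ => ?_)
    constructor
    · rintro ⟨hi, h⟩
      refine ⟨hi, ?_⟩
      have := (hbr i hi).not
      simpa using this.1 (not_le.2 h)
    · rintro ⟨hi, h⟩
      refine ⟨hi, ?_⟩
      have h2 : ¬ (0 ≤ Real.cos (θ i - θ (parent i))) := fun h0 => by
        have := (hbr i hi).1 h0; rw [h] at this; exact Bool.false_ne_true this
      exact not_le.1 h2
  · rw [t2]
    refine congrArg (· + n) (congrArg Finset.card (Finset.filter_congr fun i _ => ?_))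
    constructor
    · rintro ⟨hi, h⟩
      exact ⟨hi, (hbr i hi).1 h.le⟩
    · rintro ⟨hi, h⟩
      exact ⟨hi, lt_of_le_of_ne ((hbr i hi).2 h) (Ne.symm (hnd0 i hi))⟩

/-- ★★★ **`C(N − 1, k)` SYNCHRONOUS STATES OF TYPE `k` for the swing model on a radial network**
(strictly feasible tree flows, `Mᵢ, Dᵢ > 0`): among the `2^{N−1}` pinned synchronous states,
exactly `C(N − 1, k)` have `k` roots of the swing Jacobian in the open right half-plane; exactly
one is stable. [cite: ManikTimmeWitthaut2017, §5.2 Corollary 2; Chiang1995, §6.3 Theorem 6.1; DelabaysColettaJacquod2016, Def. 3.7] -/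
theorem ncard_pinned_syncStates_of_type {root : Fin n} {parent : Fin n → Fin n}
    {depth : Fin n → ℕ} (hroot : depth root = 0)
    (hdepth : ∀ i, i ≠ root → depth i = depth (parent i) + 1) (hC : ∀ i j, S.C i j = S.C j i)
    (htree : ∀ i j, i ≠ j → S.C i j ≠ 0 → (i ≠ root ∧ j = parent i) ∨ (j ≠ root ∧ i = parent j))
    (ha : ∀ i, i ≠ root → 0 < S.C i (parent i)) (hM : ∀ i, 0 < S.M i) (hD : ∀ i, 0 < S.D i)
    (u : Fin n → ℝ)
    (hcons : ∀ i, S.P i = (if i ≠ root then u i else 0)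
      - ∑ j ∈ Finset.univ.filter (fun j => j ≠ root ∧ parent j = i), u j)
    (hu : ∀ i, i ≠ root → |u i| < S.C i (parent i)) (k : ℕ) :
    {θ : Fin n → ℝ | θ root = 0 ∧ (∀ i, θ i ∈ Set.Ico (-π) π) ∧
      (∀ i, ∑ j, S.C i j * Real.sin (θ i - θ j) = S.P i) ∧
      ((S.phaseJac θ).map (algebraMap ℝ ℂ)).charpoly.roots.countP (fun μ => 0 < μ.re) = k}.ncard
      = (n - 1).choose k := by
  classical
  set E : Set (Fin n → ℝ) := {θ : Fin n → ℝ | θ root = 0 ∧ (∀ i, θ i ∈ Set.Ico (-π) π) ∧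
      (∀ i, ∑ j, S.C i j * Real.sin (θ i - θ j) = S.P i) ∧
      ((S.phaseJac θ).map (algebraMap ℝ ℂ)).charpoly.roots.countP (fun μ => 0 < μ.re) = k} with hE
  set T : Finset (Fin n → Bool) := Finset.univ.filter fun σ : Fin n → Bool =>
      σ root = true ∧ (Finset.univ.filter fun i => i ≠ root ∧ σ i = false).card = k with hT
  set key : (Fin n → ℝ) → (Fin n → Bool) := fun θ i =>
    if i = root then true else decide (0 ≤ Real.cos (θ i - θ (parent i))) with hkey
  have hkeycount : ∀ θ : Fin n → ℝ,
      (Finset.univ.filter fun i => i ≠ root ∧ key θ i = false)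
        = (Finset.univ.filter fun i => i ≠ root ∧ Real.cos (θ i - θ (parent i)) < 0) := by
    intro θ
    refine Finset.filter_congr fun i _ => ?_
    by_cases hi : i = root
    · simp [hi]
    · simp only [hkey, if_neg hi, decide_eq_false_iff_not, not_le]
  have hmaps : Set.MapsTo key E ↑T := by
    rintro θ ⟨-, -, heq, hk⟩
    simp only [hT, Finset.coe_filter, Finset.mem_univ, true_and, Set.mem_setOf_eq]
    refine ⟨by simp [hkey], ?_⟩
    rw [hkeycount, ← (S.radial_type_phaseJac hdepth hC htree ha hM hD u hcons hu heq).1, hk]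
  have hinj : Set.InjOn key E := by
    rintro θ ⟨hr, hbox, heq, -⟩ θ' ⟨hr', hbox', heq', -⟩ hk
    refine ClassicalModel.RadialNetwork.pinned_equilibrium_eq_of_branch_eq hdepth S.C hC htree
      (fun i hi => (ha i hi).ne') S.P hr hbox heq hr' hbox' heq' fun i hi => ?_
    have h := congr_fun hk i
    simp only [hkey, if_neg hi] at h
    simpa only [decide_eq_decide] using h
  have hsurj : Set.SurjOn key E ↑T := by
    intro σ hσ
    simp only [hT, Finset.coe_filter, Finset.mem_univ, true_and, Set.mem_setOf_eq] at hσ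
    obtain ⟨θ, hr, hbox, heq, hbr, ht, -, -⟩ :=
      S.radial_census_phaseJac hroot hdepth hC htree ha hM hD u hcons hu σ
    refine ⟨θ, ⟨hr, hbox, heq, by rw [ht, hσ.2]⟩, ?_⟩
    funext i
    by_cases hi : i = root
    · subst hi; simp [hkey, hσ.1]
    · simp only [hkey, if_neg hi]
      cases h : σ i
      · simpa [h] using hbr i hi
      · simpa [h] using hbr i hi
  have himage : key '' E = ↑T := (Set.BijOn.mk hmaps hinj hsurj).image_eq
  rw [← hinj.ncard_image, himage, Set.ncard_coe_finset, card_patterns_false_eq]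

end LosslessSystem

end ClassicalModel

end Literature.MathematicalPhysics.PowerSystems

end
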